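import Summits.QuantumFields.YangMills.Theses.GronwallGap

/-!
# `WilsonWeightBridge` (route GronwallGap, item stmt-QuantumFields-8804)

The torus Wilson measure `wilsonMeasure r.ρ β` (normalised `exp(-β S_W) ∏ dHaar`,
`S_W = ∑ₚ (N - Re tr ρ(U_p))`) coincides with the plaquette-weight measure
`groupHeatKernelMeasure (fun _ g ↦ exp (β Re tr ρ g)) s` (normalised `∏ₚ exp(β Re tr ρ(U_p)) ∏ dHaar`):
the two densities differ by the constant `c = exp(-β N · #plaquettes) ∈ (0, ∞)`, which cancels on
normalisation — including the junk cases `Z ∈ {0, ∞}`, because `(c Z)⁻¹ c = Z⁻¹` holds in `ℝ≥0∞`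
for every `Z` as soon as `c ≠ 0, ∞`.
-/

namespace Summit.QuantumFields.YangMills.Theorems

open MeasureTheory
open scoped ENNReal
open Literature.MathematicalPhysics.QuantumFieldTheory Literature.MathematicalPhysics.QuantumLattice

/-- Normalising a `withDensity` measure is insensitive to a constant factor `c ∈ (0, ∞)` in the
density: `((μ.withDensity (c f)) univ)⁻¹ • μ.withDensity (c f) = ((μ.withDensity f) univ)⁻¹ • μ.withDensity f`.
No measurability of `f` is needed (`withDensity_smul'`), and no case split on the total mass:
`(c Z)⁻¹ · c = Z⁻¹` in `ℝ≥0∞` for all `Z` once `c ≠ 0` and `c ≠ ∞`. -/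
theorem normalise_withDensity_const_mul {α : Type*} [MeasurableSpace α] (μ : Measure α)
    (f : α → ℝ≥0∞) {c : ℝ≥0∞} (hc0 : c ≠ 0) (hctop : c ≠ ∞) :
    ((μ.withDensity fun x => c * f x) Set.univ)⁻¹ • (μ.withDensity fun x => c * f x) =
      ((μ.withDensity f) Set.univ)⁻¹ • μ.withDensity f := by
  have h : (μ.withDensity fun x => c * f x) = c • μ.withDensity f := withDensity_smul' c f hctop
  rw [h, Measure.smul_apply, smul_eq_mul, ENNReal.mul_inv (Or.inl hc0) (Or.inl hctop), smul_smul,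
    mul_comm c⁻¹, mul_assoc, ENNReal.inv_mul_cancel hc0 hctop, mul_one]

/-- The Wilson density is the constant `exp(-β N #plaquettes)` times the plaquette-weight density
of the weight `g ↦ exp(β Re tr ρ g)`. -/
theorem wilson_density_eq_const_mul {G : Type*} [Group G] {N L : ℕ} [NeZero L]
    (ρ : G →* Matrix (Fin N) (Fin N) ℂ) (β s : ℝ) (U : GaugeConfig 4 L G) :
    ENNReal.ofReal (Real.exp (-β * wilsonAction ρ U)) =
      ENNReal.ofReal (Real.exp (-(β * N * Fintype.card (Plaquette 4 L)))) *
        ENNReal.ofReal (groupHeatKernelWeight (fun (_ : ℝ) (g : G) => Real.exp (β * (ρ g).trace.re)) s U) := by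
  rw [← ENNReal.ofReal_mul (Real.exp_pos _).le]
  congr 1
  simp only [wilsonAction, groupHeatKernelWeight]
  rw [← Real.exp_sum, ← Real.exp_add]
  congr 1
  rw [Finset.sum_sub_distrib, Finset.sum_const, Finset.card_univ, nsmul_eq_mul, ← Finset.mul_sum]
  ring

/-- **`WilsonWeightBridge`** (item stmt-QuantumFields-8804 of route GronwallGap): for every compact
simple `G`, lattice representation `r`, torus side `S ≥ 1` and `β, s`, the torus Wilson measure
`wilsonMeasure r.ρ β` equals the plaquette-weight measure
`groupHeatKernelMeasure (fun _ g ↦ exp (β Re tr r.ρ g)) s`; the constant `exp(-β N #plaquettes)`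
cancels on normalisation (also in the junk cases `Z ∈ {0, ∞}`). -/
theorem wilsonWeightBridge_proof :
    Summit.QuantumFields.YangMills.Theses.GronwallGap.WilsonWeightBridge := by
  intro G _ _ _ _ _hG r S _ β s
  letI : MeasurableSpace G := borel G
  haveI : BorelSpace G := ⟨rfl⟩
  show ((wilsonWeight (d := 4) (L := S) r.ρ β) Set.univ)⁻¹ • wilsonWeight (d := 4) (L := S) r.ρ β =
    ((((Measure.pi fun _ : Edge 4 S => haarProbability G).withDensity fun U =>
        ENNReal.ofReal (groupHeatKernelWeight (fun (_ : ℝ) (g : G) => Real.exp (β * (r.ρ g).trace.re)) s U))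
        Set.univ)⁻¹ •
      (Measure.pi fun _ : Edge 4 S => haarProbability G).withDensity fun U =>
        ENNReal.ofReal (groupHeatKernelWeight (fun (_ : ℝ) (g : G) => Real.exp (β * (r.ρ g).trace.re)) s U))
  have hdens : (fun U : GaugeConfig 4 S G => ENNReal.ofReal (Real.exp (-β * wilsonAction r.ρ U))) =
      fun U => ENNReal.ofReal (Real.exp (-(β * r.N * Fintype.card (Plaquette 4 S)))) *
        ENNReal.ofReal (groupHeatKernelWeight (fun (_ : ℝ) (g : G) => Real.exp (β * (r.ρ g).trace.re)) s U) :=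
    funext fun U => wilson_density_eq_const_mul r.ρ β s U
  simp only [wilsonWeight, hdens]
  exact normalise_withDensity_const_mul _ _ (ENNReal.ofReal_pos.mpr (Real.exp_pos _)).ne'
    ENNReal.ofReal_ne_top

end Summit.QuantumFields.YangMills.Theorems
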